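import Summits.QuantumFields.QCD.Theses.BanksZaksTestbed

/-!
# Birth skeleton (BC3) — crux `PinnedFiniteVolumeLimit`
route `route-QuantumFields-BanksZaksTestbed`, item `stmt-QuantumFields-17635`, sub-problem `QCD`.
Registrar: planner-skel-stmt-QuantumFields-17635-0 (2026-08-17, mode skeleton-register, gen 1).
Tree path `Summits/QuantumFields/QCD/Cruxes/PinnedFiniteVolumeLimit/Lines/birth.lean`.

The crux (rank 5, "the chain's existence half, pinned"): for `N_f = 2` AND `N_f = 3` there is ONE
mass-independent regularisation `reg` (leading-log mass scaling, `N_f`-flavour two-loop asymptotic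
scaling, `m_crit(k) > −1` eventually) which is CHIRAL AT ZERO (`reg.IsChiralAtZero`) and along which,
for EVERY positive mass tuple, the guarded finite-volume continuum limits of `WindowFiniteVolumeLimitR`
hold (CONV on every torus of physical side `ℓ ≥ ℓ₀` for in-ball pairwise-disjoint Schwartz tuples;
N1/N2 in-ball time-separated, N3 in-ball pairwise-disjoint).

## The cut — the flavour ladder with the pin sharpened to CHIRAL REACH

The crux is a conjunction over the two physical flavour numbers, and its only outermost universal
structure is `∀ N_f ∈ {2,3}`; everything else sits under the one existential `∃ reg` (the pin and the
body must hold for the SAME regularisation, so no result-level UV/IR cut is expressible without the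
block-RG vocabulary the route has requested as definitions D1/D2). The honest typed decomposition
available today is therefore the FLAVOUR LADDER, with each rung stated in the form the route's two-layer
plan actually intends to prove (`PinnedFiniteVolumeLimit ⇐ W|_{N_f} with the RG-chiral reference →
ChiralReach`): the pin is SHARPENED from the Statement's `IsChiralAtZero` (some positive tuple is
ε-gapless) to CHIRAL REACH ALONG THE FLAVOUR-SYMMETRIC LINE — for every `ε > 0` some DEGENERATE positive
mass `(μ, …, μ)` has no volume-uniform lattice gap `ε` (pseudo-Goldstone bosons of the vector-symmetric
theory; `m_crit` is flavour-blind, so the degenerate direction is the canonical approach to the chiral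
point).

* `stub_twoFlavourChiralReach` — the `N_f = 2` rung: isospin-symmetric chiral reach + the guarded
  finite-volume continuum limits for all positive `(m_u, m_d)`. Even flavour number: for degenerate
  pairs the Wilson weight is a square, and the chiral dynamics is `SU(2) × SU(2) → SU(2)` (three pions;
  Aoki/Sharpe–Singleton lattice phase structure known best here). The first rung of the ladder.
* `stub_threeFlavourChiralReach` — the `N_f = 3` rung: `SU(3)`-symmetric chiral reach + the guarded
  limits for all positive `(m_u, m_d, m_s)`. Odd flavour number: the signed Wilson determinant under
  mass splittings (the route's own listed risk for W), `b₀(3) ≠ b₀(2)` (a different asymptotically free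
  theory, not a corollary of the `N_f = 2` rung), eight pseudo-Goldstones.
* `PinnedFiniteVolumeLimit_of` — kernel-checked composition: case split `N_f = 2 ∨ N_f = 3` (`omega`),
  and on each rung the degenerate chiral reach yields `reg.IsChiralAtZero` (witness tuple `fun _ => μ`).

Both stubs are stated over existing declarations only (verbatim sub-clauses of the route decl, `Nf`
instantiated, the pin conjunct replaced by its degenerate sharpening). Neither is the crux (each lacks
the other flavour number; BC3 probes `stub → crux`, `stub → QCD` by `exact? | simpa | aesop` fail — see
`Lines/birth.md`), and neither is implied by a landed theorem.
-/

namespace Summit.QuantumFields.QCD.Cruxes.PinnedFiniteVolumeLimit.Birth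

open scoped BigOperators
open Filter

/-- **Stub 1 — two flavours: isospin-symmetric chiral reach + guarded finite-volume continuum
limits.** There is ONE mass-independent regularisation `reg : QCDRegularisation 2` with leading-log
mass scaling, two-flavour two-loop asymptotic scaling and `m_crit(k) > −1` eventually, whose reference
REACHES THE CHIRAL POINT ALONG THE DEGENERATE LINE — for every `ε > 0` some `μ > 0` such that the
lattice theories at renormalised masses `(μ, μ)` have no volume-uniform lattice gap `ε` (light pions,
`m_π² ≍ B μ`, uniformly in the volume: the NEGATION of a uniform gap, no condensate or Dirac spectral
gap needed) — and such that for EVERY positive mass pair the guarded body of `WindowFiniteVolumeLimitR`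
holds verbatim at `N_f = 2` (CONV for in-ball pairwise-disjoint tuples on the torus of side
`2⌊ℓ/2a_k⌋+1`, every `ℓ ≥ ℓ₀`; N2 for `pseudoRe 0 1`, `pseudoRe 1 0`; N1, N3 for glue).
Why plausibly true: W's construction (bounded-coupling block RG down to `μ₀`, finite-box compactness,
mass equicontinuity) run with the RG-chiral reference, plus Goldstone's theorem from above in the
cleanest case (even `N_f`, square weight on the degenerate line). Size: XL.
Leans on: `QCDRegularisation.scheme`, `QCDScheme.HasLatticeMassGap`, `qcdTorusExpect`, `insertion`,
`afBeta`, `box`, `siteToE` (tree); Balaban1989LargeFieldII, BalabanOcarrollSchor1989,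
MontvayMunster1994 §5.1, GellmannOakesRenner1968, GasserLeutwyler1984, SharpeSingleton1998. -/
theorem stub_twoFlavourChiralReach :
    ∃ reg : Literature.MathematicalPhysics.QuantumFieldTheory.QCDRegularisation 2, (reg.HasMassScaling ∧ (∃ Λ > 0, Tendsto (fun k => reg.β k - Literature.MathematicalPhysics.QuantumFieldTheory.afBeta 2 Λ (reg.a k)) atTop (nhds 0)) ∧ (∀ᶠ k in atTop, (-1 : ℝ) < reg.mcrit k) ∧ (∀ ε > (0 : ℝ), ∃ μ : ℝ, 0 < μ ∧ ¬ (reg.scheme (fun _ : Fin 2 => μ) 0 0).HasLatticeMassGap ε)) ∧ (∀ m : Fin 2 → ℝ, (∀ fl, 0 < m fl) → ∃ z shift : Literature.MathematicalPhysics.QuantumFieldTheory.QCDField 2 → ℕ → ℝ, ∃ W : ((ℓ : ℝ) → (n : ℕ) → (Fin n → Literature.MathematicalPhysics.QuantumFieldTheory.QCDField 2) → (Fin n → SchwartzMap (EuclideanSpace ℝ (Fin 4)) ℝ) → ℂ), ∃ ℓ₀ > 0, (∀ ℓ : ℝ, ℓ₀ ≤ ℓ → ∀ (n : ℕ) (σ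 : Fin n → Literature.MathematicalPhysics.QuantumFieldTheory.QCDField 2) (f : Fin n → SchwartzMap (EuclideanSpace ℝ (Fin 4)) ℝ), (∀ i : Fin n, tsupport (f i) ⊆ Metric.ball 0 (ℓ / 4)) → (∀ i j : Fin n, i ≠ j → Disjoint (tsupport (f i)) (tsupport (f j))) → Tendsto (fun k => Literature.MathematicalPhysics.QuantumFieldTheory.qcdTorusExpect (reg.β k) (2 * ⌊ℓ / (2 * reg.a k)⌋₊ + 1) (fun fl => (reg.scheme m 0 0).mq fl k) (fun U => (List.ofFn fun i : Fin n => (∑ x ∈ Literature.Probability.LatticeModels.box 4 ⌊ℓ / (2 * reg.a k)⌋₊, ((z (σ i) k * reg.a k ^ 4 * (f i) (reg.a k • Literature.MathematicalPhysics.QuantumLattice.siteToE x) : ℝ) : ℂ) • (Literature.MathematicalPhysics.QuantumFieldTheory.insertion U (σ i) x - algebraMap ℂ _ (((shift (σ i) k) : ℝ) : ℂ)))).prod)) atTop (nhds (W ℓ n σ f))) ∧ (∀ fl gl : Fin 2, fl ≠ gl → ∃ ℓ : ℝ, ℓ₀ ≤ ℓ ∧ ∃ f g : SchwartzMap (EuclideanSpace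 ℝ (Fin 4)) ℝ, tsupport f ⊆ Metric.ball 0 (ℓ / 4) ∧ tsupport g ⊆ Metric.ball 0 (ℓ / 4) ∧ tsupport f ⊆ {x | x 0 < 0} ∧ tsupport g ⊆ {x | 0 < x 0} ∧ W ℓ 2 (fun _ => Literature.MathematicalPhysics.QuantumFieldTheory.QCDField.pseudoRe fl gl) ![f, g] ≠ W ℓ 1 (fun _ => Literature.MathematicalPhysics.QuantumFieldTheory.QCDField.pseudoRe fl gl) ![f] * W ℓ 1 (fun _ => Literature.MathematicalPhysics.QuantumFieldTheory.QCDField.pseudoRe fl gl) ![g]) ∧ ∀ s₀ : Literature.MathematicalPhysics.QuantumFieldTheory.QCDField 2, s₀ = Literature.MathematicalPhysics.QuantumFieldTheory.QCDField.glue → (∃ ℓ : ℝ, ℓ₀ ≤ ℓ ∧ ∃ f g : SchwartzMap (EuclideanSpace ℝ (Fin 4)) ℝ, tsupport f ⊆ Metric.ball 0 (ℓ / 4) ∧ tsupport g ⊆ Metric.ball 0 (ℓ / 4) ∧ tsupport f ⊆ {x | x 0 < 0} ∧ tsupport g ⊆ {x | 0 < x 0} ∧ W ℓ 2 (fun _ =>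 s₀) ![f, g] ≠ W ℓ 1 (fun _ => s₀) ![f] * W ℓ 1 (fun _ => s₀) ![g]) ∧ (∃ ℓ : ℝ, ℓ₀ ≤ ℓ ∧ ∃ f g h : SchwartzMap (EuclideanSpace ℝ (Fin 4)) ℝ, tsupport f ⊆ Metric.ball 0 (ℓ / 4) ∧ tsupport g ⊆ Metric.ball 0 (ℓ / 4) ∧ tsupport h ⊆ Metric.ball 0 (ℓ / 4) ∧ Disjoint (tsupport f) (tsupport g) ∧ Disjoint (tsupport f) (tsupport h) ∧ Disjoint (tsupport g) (tsupport h) ∧ W ℓ 3 (fun _ => s₀) ![f, g, h] - W ℓ 1 (fun _ => s₀) ![f] * W ℓ 2 (fun _ => s₀) ![g, h] - W ℓ 1 (fun _ => s₀) ![g] * W ℓ 2 (fun _ => s₀) ![f, h] - W ℓ 1 (fun _ => s₀) ![h] * W ℓ 2 (fun _ => s₀) ![f, g] + 2 * (W ℓ 1 (fun _ => s₀) ![f] * W ℓ 1 (fun _ => s₀) ![g] * W ℓ 1 (fun _ => s₀) ![h]) ≠ 0)) := by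
  sorry

/-- **Stub 2 — three flavours: `SU(3)`-symmetric chiral reach + guarded finite-volume continuum
limits.** The same rung at `N_f = 3`: ONE mass-independent `reg : QCDRegularisation 3` (mass scaling,
three-flavour two-loop asymptotic scaling — `b₀(3)`, `b₁(3)`, `γ₀/2b₀` at `N_f = 3` — and
`m_crit(k) > −1` eventually) with chiral reach along the degenerate line `(μ, μ, μ)`, `μ → 0⁺` (eight
pseudo-Goldstones), and the guarded body for EVERY positive triple `(m_u, m_d, m_s)` — all splittings,
where for odd `N_f` the Wilson fermion weight is SIGNED (the route's listed risk: `∏_f det(D_W + m_f)`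
need not be positive configuration-wise once the masses split), so a-uniform bounds cannot lean on
positivity. Not a corollary of Stub 1 (different `b₀`, different theory). Size: XL.
Leans on: as Stub 1; VafaWitten1984CMP (vector-symmetry protection on the degenerate line),
MontvayMunster1994 §4.1/§5.1 (signed determinant, critical hopping parameter). -/
theorem stub_threeFlavourChiralReach :
    ∃ reg : Literature.MathematicalPhysics.QuantumFieldTheory.QCDRegularisation 3, (reg.HasMassScaling ∧ (∃ Λ > 0, Tendsto (fun k => reg.β k - Literature.MathematicalPhysics.QuantumFieldTheory.afBeta 3 Λ (reg.a k)) atTop (nhds 0)) ∧ (∀ᶠ k in atTop, (-1 : ℝ) < reg.mcrit k) ∧ (∀ ε > (0 : ℝ), ∃ μ : ℝ, 0 < μ ∧ ¬ (reg.scheme (fun _ : Fin 3 => μ) 0 0).HasLatticeMassGap ε)) ∧ (∀ m : Fin 3 → ℝ, (∀ fl, 0 < m fl) → ∃ z shift : Literature.MathematicalPhysics.QuantumFieldTheory.QCDField 3 → ℕ → ℝ, ∃ W : ((ℓ : ℝ) → (n : ℕ) → (Fin n → Literature.MathematicalPhysics.QuantumFieldTheory.QCDField 3) → (Fin n → SchwartzMap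 (EuclideanSpace ℝ (Fin 4)) ℝ) → ℂ), ∃ ℓ₀ > 0, (∀ ℓ : ℝ, ℓ₀ ≤ ℓ → ∀ (n : ℕ) (σ : Fin n → Literature.MathematicalPhysics.QuantumFieldTheory.QCDField 3) (f : Fin n → SchwartzMap (EuclideanSpace ℝ (Fin 4)) ℝ), (∀ i : Fin n, tsupport (f i) ⊆ Metric.ball 0 (ℓ / 4)) → (∀ i j : Fin n, i ≠ j → Disjoint (tsupport (f i)) (tsupport (f j))) → Tendsto (fun k => Literature.MathematicalPhysics.QuantumFieldTheory.qcdTorusExpect (reg.β k) (2 * ⌊ℓ / (2 * reg.a k)⌋₊ + 1) (fun fl => (reg.scheme m 0 0).mq fl k) (fun U => (List.ofFn fun i : Fin n => (∑ x ∈ Literature.Probability.LatticeModels.box 4 ⌊ℓ / (2 * reg.a k)⌋₊, ((z (σ i) k * reg.a k ^ 4 * (f i) (reg.a k • Literature.MathematicalPhysics.QuantumLattice.siteToE x) : ℝ) : ℂ) • (Literature.MathematicalPhysics.QuantumFieldTheory.insertion U (σ i) x - algebraMap ℂ _ (((shift (σ i) k) : ℝ) : ℂ)))).prod)) atTop (nhds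 (W ℓ n σ f))) ∧ (∀ fl gl : Fin 3, fl ≠ gl → ∃ ℓ : ℝ, ℓ₀ ≤ ℓ ∧ ∃ f g : SchwartzMap (EuclideanSpace ℝ (Fin 4)) ℝ, tsupport f ⊆ Metric.ball 0 (ℓ / 4) ∧ tsupport g ⊆ Metric.ball 0 (ℓ / 4) ∧ tsupport f ⊆ {x | x 0 < 0} ∧ tsupport g ⊆ {x | 0 < x 0} ∧ W ℓ 2 (fun _ => Literature.MathematicalPhysics.QuantumFieldTheory.QCDField.pseudoRe fl gl) ![f, g] ≠ W ℓ 1 (fun _ => Literature.MathematicalPhysics.QuantumFieldTheory.QCDField.pseudoRe fl gl) ![f] * W ℓ 1 (fun _ => Literature.MathematicalPhysics.QuantumFieldTheory.QCDField.pseudoRe fl gl) ![g]) ∧ ∀ s₀ : Literature.MathematicalPhysics.QuantumFieldTheory.QCDField 3, s₀ = Literature.MathematicalPhysics.QuantumFieldTheory.QCDField.glue → (∃ ℓ : ℝ, ℓ₀ ≤ ℓ ∧ ∃ f g : SchwartzMap (EuclideanSpace ℝ (Fin 4)) ℝ, tsupport f ⊆ Metric.ball 0 (ℓ / 4) ∧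 tsupport g ⊆ Metric.ball 0 (ℓ / 4) ∧ tsupport f ⊆ {x | x 0 < 0} ∧ tsupport g ⊆ {x | 0 < x 0} ∧ W ℓ 2 (fun _ => s₀) ![f, g] ≠ W ℓ 1 (fun _ => s₀) ![f] * W ℓ 1 (fun _ => s₀) ![g]) ∧ (∃ ℓ : ℝ, ℓ₀ ≤ ℓ ∧ ∃ f g h : SchwartzMap (EuclideanSpace ℝ (Fin 4)) ℝ, tsupport f ⊆ Metric.ball 0 (ℓ / 4) ∧ tsupport g ⊆ Metric.ball 0 (ℓ / 4) ∧ tsupport h ⊆ Metric.ball 0 (ℓ / 4) ∧ Disjoint (tsupport f) (tsupport g) ∧ Disjoint (tsupport f) (tsupport h) ∧ Disjoint (tsupport g) (tsupport h) ∧ W ℓ 3 (fun _ => s₀) ![f, g, h] - W ℓ 1 (fun _ => s₀) ![f] * W ℓ 2 (fun _ => s₀) ![g, h] - W ℓ 1 (fun _ => s₀) ![g] * W ℓ 2 (fun _ => s₀) ![f, h] - W ℓ 1 (fun _ => s₀) ![h] * W ℓ 2 (fun _ => s₀) ![f, g] + 2 * (W ℓ 1 (fun _ => s₀) ![f] * W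 ℓ 1 (fun _ => s₀) ![g] * W ℓ 1 (fun _ => s₀) ![h]) ≠ 0)) := by
  sorry

set_option maxHeartbeats 800000 in
/-- **Composition (kernel-checked, no sorry): the two rungs give the crux BY NAME.** Case split on the
flavour number (`2 ≤ N_f ≤ 3 ⇒ N_f = 2 ∨ N_f = 3`); on each rung the regularisation, its three scaling
properties and the guarded body are passed through verbatim, and the degenerate chiral reach is
weakened to the Statement's pin `reg.IsChiralAtZero` with the witness tuple `fun _ => μ`. -/
theorem PinnedFiniteVolumeLimit_of :
    (∃ reg : Literature.MathematicalPhysics.QuantumFieldTheory.QCDRegularisation 2, (reg.HasMassScaling ∧ (∃ Λ > 0, Tendsto (fun k => reg.β k - Literature.MathematicalPhysics.QuantumFieldTheory.afBeta 2 Λ (reg.a k)) atTop (nhds 0)) ∧ (∀ᶠ k in atTop, (-1 : ℝ) < reg.mcrit k) ∧ (∀ ε > (0 : ℝ), ∃ μ : ℝ, 0 < μ ∧ ¬ (reg.scheme (fun _ : Fin 2 => μ) 0 0).HasLatticeMassGap ε)) ∧ (∀ m : Fin 2 → ℝ, (∀ fl, 0 < m fl) → ∃ z shift : Literature.MathematicalPhysics.QuantumFieldTheory.QCDField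 2 → ℕ → ℝ, ∃ W : ((ℓ : ℝ) → (n : ℕ) → (Fin n → Literature.MathematicalPhysics.QuantumFieldTheory.QCDField 2) → (Fin n → SchwartzMap (EuclideanSpace ℝ (Fin 4)) ℝ) → ℂ), ∃ ℓ₀ > 0, (∀ ℓ : ℝ, ℓ₀ ≤ ℓ → ∀ (n : ℕ) (σ : Fin n → Literature.MathematicalPhysics.QuantumFieldTheory.QCDField 2) (f : Fin n → SchwartzMap (EuclideanSpace ℝ (Fin 4)) ℝ), (∀ i : Fin n, tsupport (f i) ⊆ Metric.ball 0 (ℓ / 4)) → (∀ i j : Fin n, i ≠ j → Disjoint (tsupport (f i)) (tsupport (f j))) → Tendsto (fun k => Literature.MathematicalPhysics.QuantumFieldTheory.qcdTorusExpect (reg.β k) (2 * ⌊ℓ / (2 * reg.a k)⌋₊ + 1) (fun fl => (reg.scheme m 0 0).mq fl k) (fun U => (List.ofFn fun i : Fin n => (∑ x ∈ Literature.Probability.LatticeModels.box 4 ⌊ℓ / (2 * reg.a k)⌋₊, ((z (σ i) k * reg.a k ^ 4 * (f i) (reg.a k • Literature.MathematicalPhysics.QuantumLattice.siteToE x) : ℝ)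 : ℂ) • (Literature.MathematicalPhysics.QuantumFieldTheory.insertion U (σ i) x - algebraMap ℂ _ (((shift (σ i) k) : ℝ) : ℂ)))).prod)) atTop (nhds (W ℓ n σ f))) ∧ (∀ fl gl : Fin 2, fl ≠ gl → ∃ ℓ : ℝ, ℓ₀ ≤ ℓ ∧ ∃ f g : SchwartzMap (EuclideanSpace ℝ (Fin 4)) ℝ, tsupport f ⊆ Metric.ball 0 (ℓ / 4) ∧ tsupport g ⊆ Metric.ball 0 (ℓ / 4) ∧ tsupport f ⊆ {x | x 0 < 0} ∧ tsupport g ⊆ {x | 0 < x 0} ∧ W ℓ 2 (fun _ => Literature.MathematicalPhysics.QuantumFieldTheory.QCDField.pseudoRe fl gl) ![f, g] ≠ W ℓ 1 (fun _ => Literature.MathematicalPhysics.QuantumFieldTheory.QCDField.pseudoRe fl gl) ![f] * W ℓ 1 (fun _ => Literature.MathematicalPhysics.QuantumFieldTheory.QCDField.pseudoRe fl gl) ![g]) ∧ ∀ s₀ : Literature.MathematicalPhysics.QuantumFieldTheory.QCDField 2, s₀ = Literature.MathematicalPhysics.QuantumFieldTheory.QCDField.glue → (∃ ℓ : ℝ,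 ℓ₀ ≤ ℓ ∧ ∃ f g : SchwartzMap (EuclideanSpace ℝ (Fin 4)) ℝ, tsupport f ⊆ Metric.ball 0 (ℓ / 4) ∧ tsupport g ⊆ Metric.ball 0 (ℓ / 4) ∧ tsupport f ⊆ {x | x 0 < 0} ∧ tsupport g ⊆ {x | 0 < x 0} ∧ W ℓ 2 (fun _ => s₀) ![f, g] ≠ W ℓ 1 (fun _ => s₀) ![f] * W ℓ 1 (fun _ => s₀) ![g]) ∧ (∃ ℓ : ℝ, ℓ₀ ≤ ℓ ∧ ∃ f g h : SchwartzMap (EuclideanSpace ℝ (Fin 4)) ℝ, tsupport f ⊆ Metric.ball 0 (ℓ / 4) ∧ tsupport g ⊆ Metric.ball 0 (ℓ / 4) ∧ tsupport h ⊆ Metric.ball 0 (ℓ / 4) ∧ Disjoint (tsupport f) (tsupport g) ∧ Disjoint (tsupport f) (tsupport h) ∧ Disjoint (tsupport g) (tsupport h) ∧ W ℓ 3 (fun _ => s₀) ![f, g, h] - W ℓ 1 (fun _ => s₀) ![f] * W ℓ 2 (fun _ => s₀) ![g, h] - W ℓ 1 (fun _ => s₀) ![g] * W ℓ 2 (fun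 _ => s₀) ![f, h] - W ℓ 1 (fun _ => s₀) ![h] * W ℓ 2 (fun _ => s₀) ![f, g] + 2 * (W ℓ 1 (fun _ => s₀) ![f] * W ℓ 1 (fun _ => s₀) ![g] * W ℓ 1 (fun _ => s₀) ![h]) ≠ 0))) →
    (∃ reg : Literature.MathematicalPhysics.QuantumFieldTheory.QCDRegularisation 3, (reg.HasMassScaling ∧ (∃ Λ > 0, Tendsto (fun k => reg.β k - Literature.MathematicalPhysics.QuantumFieldTheory.afBeta 3 Λ (reg.a k)) atTop (nhds 0)) ∧ (∀ᶠ k in atTop, (-1 : ℝ) < reg.mcrit k) ∧ (∀ ε > (0 : ℝ), ∃ μ : ℝ, 0 < μ ∧ ¬ (reg.scheme (fun _ : Fin 3 => μ) 0 0).HasLatticeMassGap ε)) ∧ (∀ m : Fin 3 → ℝ, (∀ fl, 0 < m fl) → ∃ z shift : Literature.MathematicalPhysics.QuantumFieldTheory.QCDField 3 → ℕ → ℝ, ∃ W : ((ℓ : ℝ) → (n : ℕ) → (Fin n → Literature.MathematicalPhysics.QuantumFieldTheory.QCDField 3) → (Fin n → SchwartzMap (EuclideanSpace ℝ (Fin 4))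 ℝ) → ℂ), ∃ ℓ₀ > 0, (∀ ℓ : ℝ, ℓ₀ ≤ ℓ → ∀ (n : ℕ) (σ : Fin n → Literature.MathematicalPhysics.QuantumFieldTheory.QCDField 3) (f : Fin n → SchwartzMap (EuclideanSpace ℝ (Fin 4)) ℝ), (∀ i : Fin n, tsupport (f i) ⊆ Metric.ball 0 (ℓ / 4)) → (∀ i j : Fin n, i ≠ j → Disjoint (tsupport (f i)) (tsupport (f j))) → Tendsto (fun k => Literature.MathematicalPhysics.QuantumFieldTheory.qcdTorusExpect (reg.β k) (2 * ⌊ℓ / (2 * reg.a k)⌋₊ + 1) (fun fl => (reg.scheme m 0 0).mq fl k) (fun U => (List.ofFn fun i : Fin n => (∑ x ∈ Literature.Probability.LatticeModels.box 4 ⌊ℓ / (2 * reg.a k)⌋₊, ((z (σ i) k * reg.a k ^ 4 * (f i) (reg.a k • Literature.MathematicalPhysics.QuantumLattice.siteToE x) : ℝ) : ℂ) • (Literature.MathematicalPhysics.QuantumFieldTheory.insertion U (σ i) x - algebraMap ℂ _ (((shift (σ i) k) : ℝ) : ℂ)))).prod)) atTop (nhds (W ℓ n σ f))) ∧ (∀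 fl gl : Fin 3, fl ≠ gl → ∃ ℓ : ℝ, ℓ₀ ≤ ℓ ∧ ∃ f g : SchwartzMap (EuclideanSpace ℝ (Fin 4)) ℝ, tsupport f ⊆ Metric.ball 0 (ℓ / 4) ∧ tsupport g ⊆ Metric.ball 0 (ℓ / 4) ∧ tsupport f ⊆ {x | x 0 < 0} ∧ tsupport g ⊆ {x | 0 < x 0} ∧ W ℓ 2 (fun _ => Literature.MathematicalPhysics.QuantumFieldTheory.QCDField.pseudoRe fl gl) ![f, g] ≠ W ℓ 1 (fun _ => Literature.MathematicalPhysics.QuantumFieldTheory.QCDField.pseudoRe fl gl) ![f] * W ℓ 1 (fun _ => Literature.MathematicalPhysics.QuantumFieldTheory.QCDField.pseudoRe fl gl) ![g]) ∧ ∀ s₀ : Literature.MathematicalPhysics.QuantumFieldTheory.QCDField 3, s₀ = Literature.MathematicalPhysics.QuantumFieldTheory.QCDField.glue → (∃ ℓ : ℝ, ℓ₀ ≤ ℓ ∧ ∃ f g : SchwartzMap (EuclideanSpace ℝ (Fin 4)) ℝ, tsupport f ⊆ Metric.ball 0 (ℓ / 4) ∧ tsupport g ⊆ Metric.ball 0 (ℓ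 / 4) ∧ tsupport f ⊆ {x | x 0 < 0} ∧ tsupport g ⊆ {x | 0 < x 0} ∧ W ℓ 2 (fun _ => s₀) ![f, g] ≠ W ℓ 1 (fun _ => s₀) ![f] * W ℓ 1 (fun _ => s₀) ![g]) ∧ (∃ ℓ : ℝ, ℓ₀ ≤ ℓ ∧ ∃ f g h : SchwartzMap (EuclideanSpace ℝ (Fin 4)) ℝ, tsupport f ⊆ Metric.ball 0 (ℓ / 4) ∧ tsupport g ⊆ Metric.ball 0 (ℓ / 4) ∧ tsupport h ⊆ Metric.ball 0 (ℓ / 4) ∧ Disjoint (tsupport f) (tsupport g) ∧ Disjoint (tsupport f) (tsupport h) ∧ Disjoint (tsupport g) (tsupport h) ∧ W ℓ 3 (fun _ => s₀) ![f, g, h] - W ℓ 1 (fun _ => s₀) ![f] * W ℓ 2 (fun _ => s₀) ![g, h] - W ℓ 1 (fun _ => s₀) ![g] * W ℓ 2 (fun _ => s₀) ![f, h] - W ℓ 1 (fun _ => s₀) ![h] * W ℓ 2 (fun _ => s₀) ![f, g] + 2 * (W ℓ 1 (fun _ => s₀) ![f] * W ℓ 1 (fun _ => s₀) ![g] * W ℓ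 1 (fun _ => s₀) ![h]) ≠ 0))) →
    Summit.QuantumFields.QCD.Theses.BanksZaksTestbed.PinnedFiniteVolumeLimit := by
  intro h2 h3 Nf hlo hhi
  obtain rfl | rfl : Nf = 2 ∨ Nf = 3 := by omega
  · obtain ⟨reg, ⟨hM, hAF, hbr, hpin⟩, hbody⟩ := h2
    refine ⟨reg, ⟨hM, hAF, hbr, ?_⟩, hbody⟩
    intro ε hε
    obtain ⟨μ, hμ, hgap⟩ := hpin ε hε
    exact ⟨fun _ => μ, fun _ => hμ, hgap⟩
  · obtain ⟨reg, ⟨hM, hAF, hbr, hpin⟩, hbody⟩ := h3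
    refine ⟨reg, ⟨hM, hAF, hbr, ?_⟩, hbody⟩
    intro ε hε
    obtain ⟨μ, hμ, hgap⟩ := hpin ε hε
    exact ⟨fun _ => μ, fun _ => hμ, hgap⟩

/-- **The skeleton IS the crux proof modulo the registered stubs**: `PinnedFiniteVolumeLimit` by name,
from `stub_twoFlavourChiralReach` and `stub_threeFlavourChiralReach` through
`PinnedFiniteVolumeLimit_of` (sorries live only inside the two stubs). -/
theorem PinnedFiniteVolumeLimit_skeleton :
    Summit.QuantumFields.QCD.Theses.BanksZaksTestbed.PinnedFiniteVolumeLimit :=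
  PinnedFiniteVolumeLimit_of stub_twoFlavourChiralReach stub_threeFlavourChiralReach

end Summit.QuantumFields.QCD.Cruxes.PinnedFiniteVolumeLimit.Birth
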